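import Literature.Barriers.ValiantsHypothesis.MonotoneGapPermanentProofs
import Literature.Barriers.ValiantsHypothesis.MonotoneGapProofs
import Literature.Computability.AlgebraicComplexity.LaurentPolyOrder
import Literature.Computability.AlgebraicComplexity.CircuitGateSemantics
import HarnessLib

/-!
# Route `VPBoundarySquare` — MONOTONE BORDER = MONOTONE EXACT; BORDER JS82; border-robust gap

Decomp-valiant workshop, lens 3 «border / debordering axis», gen 33, offer O9 (called by the
critic).  Unconditional, 0 sorry, no named fact, no new `Prop` (four local construction `def`s:
`slice`, `epsOrd`, `debOp`, `deborder`).  CALIBRATION: does NOT prove `VP ≠ VNP`, moves no tag.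
A MONOTONE `ε`-CIRCUIT is a plain fan-in-two `ArithCircuit` over `ℝ((ε)) = LaurentSeries ℝ` (the
tree's Jerrum–Snir model `IsPlain`/`IsFanInTwo`/`prodCount`) whose constant operands `c` have
`0 ≤ c.leadingCoeff` (`c(ε) ≥ 0` for small `ε > 0`, poles allowed); it APPROXIMATES `f ∈ ℝ≥0[x]`
when `P.eval - f = O(ε)` (`PolyOrdGE 1`).  MECHANISM `map_gateVal_deborder` (initial forms, NOT
rank semicontinuity): positivity ⇒ no cancellation ⇒ lowest-`ε`-order parts multiply at `⊗`-gates
and add over the least-order operands at `⊕`-gates, so `deborder P` (same gates over `ℝ≥0`)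
computes them, size and `⊗`-count preserved; ★ `exists_isMonotoneComputation_of_border`.
PRINT STATUS (grade of record: known-in-print-as-ADJACENT-theorem, kernel-new, rung 0, CALIBRATION,
0 new currency, `VP ≠ VNP` untouched): the initial-form induction IS Grochow–Mulmuley–Qiao 2016
Thm. 16 (arXiv:1605.02815 §7.2; there for TORIC degenerations, here for arbitrary `ε`-positive
families); the closure statement is printed for monotone ABP FORMAT (Bläser–Ikenmeyer–Mahajan–
Pandey–Saurabh 2020 Thm. 3, arXiv:2003.04834 §4) and is their §1 «intuition» sentence for circuits,
which FAILS for monotone trace-ABP width (same paper), so it is not automatic; found as a theorem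
nowhere.  References: [GrochowMulmuleyQiao2016] Thm. 16; [BlaserIkenmeyerMahajanPandeySaurabh2020]
§1, §4 Thm. 3; [JerrumSnir1982] §2, §4.3, §4.5; [AndrewsForbes2022] Def. 2.1 (arXiv:2112.00792).
-/

noncomputable section

set_option linter.dupNamespace false -- layout Summits/P/P forces the duplicated component

namespace Summit.ValiantsHypothesis.ValiantsHypothesis.Theorems.VPBoundarySquare

open MvPolynomial Literature.Computability.AlgebraicComplexity
open Literature.Barriers.ValiantsHypothesis
open scoped NNReal

variable {σ : Type*}

/-- The `ε^a`-SLICE of `G ∈ ℝ((ε))[x]`, a real polynomial. [cite: GrochowMulmuleyQiao2016] -/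
def slice (a : ℤ) (G : MvPolynomial σ (LaurentSeries ℝ)) : MvPolynomial σ ℝ :=
  (AddMonoidAlgebra.map (HahnSeries.coeff.addMonoidHom a) G : MvPolynomial σ ℝ)

/-- Coefficients of a slice (definitional). [folklore] -/
theorem coeff_slice (a : ℤ) (G : MvPolynomial σ (LaurentSeries ℝ)) (m : σ →₀ ℕ) :
    coeff m (slice a G) = (coeff m G).coeff a := rfl

/-- `slice a 0 = 0`. [folklore] -/
theorem slice_zero (a : ℤ) : slice a (0 : MvPolynomial σ (LaurentSeries ℝ)) = 0 :=
  MvPolynomial.ext _ _ fun m => by rw [coeff_slice, coeff_zero, coeff_zero, HahnSeries.coeff_zero]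

/-- Slices are additive. [folklore] -/
theorem slice_add (a : ℤ) (G H : MvPolynomial σ (LaurentSeries ℝ)) :
    slice a (G + H) = slice a G + slice a H := MvPolynomial.ext _ _ fun m => by
  rw [coeff_add, coeff_slice, coeff_slice, coeff_slice, coeff_add, HahnSeries.coeff_add]

/-- Slices below the order vanish. [folklore] -/
theorem slice_eq_zero_of_polyOrdGE {a b : ℤ} {G : MvPolynomial σ (LaurentSeries ℝ)}
    (hG : PolyOrdGE a G) (hb : b < a) : slice b G = 0 :=
  MvPolynomial.ext _ _ fun m => by rw [coeff_slice, coeff_zero, hG m b hb]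

/-- The `ε^{a+b}`-coefficient of a product of an `O(ε^a)` and an `O(ε^b)` series. [folklore] -/
theorem hahn_coeff_mul_of_isOrdGE {x y : LaurentSeries ℝ} {a b : ℤ} (hx : IsOrdGE a x)
    (hy : IsOrdGE b y) : (x * y).coeff (a + b) = x.coeff a * y.coeff b := by
  rcases eq_or_ne x 0 with rfl | hx0; · simp
  rcases eq_or_ne y 0 with rfl | hy0; · simp
  have ha : a ≤ x.order := le_of_not_gt fun h => HahnSeries.coeff_order_eq_zero.not.2 hx0 (hx _ h)
  have hb : b ≤ y.order := le_of_not_gt fun h => HahnSeries.coeff_order_eq_zero.not.2 hy0 (hy _ h)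
  have hord : (x * y).order = x.order + y.order := HahnSeries.order_mul_of_ne_zero
    (mul_ne_zero (HahnSeries.leadingCoeff_ne_zero.2 hx0) (HahnSeries.leadingCoeff_ne_zero.2 hy0))
  rcases ha.lt_or_eq with ha | ha
  · rw [HahnSeries.coeff_eq_zero_of_lt_order (by rw [hord]; omega),
      HahnSeries.coeff_eq_zero_of_lt_order ha, zero_mul]
  rcases hb.lt_or_eq with hb | hb
  · rw [HahnSeries.coeff_eq_zero_of_lt_order (by rw [hord]; omega),
      HahnSeries.coeff_eq_zero_of_lt_order hb, mul_zero]
  rw [ha, hb, HahnSeries.coeff_mul_order_add_order, HahnSeries.leadingCoeff_eq,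
    HahnSeries.leadingCoeff_eq]

/-- **Slices multiply at the orders.** [cite: GrochowMulmuleyQiao2016, Thm. 16] -/
theorem slice_mul {a b : ℤ} {G H : MvPolynomial σ (LaurentSeries ℝ)} (hG : PolyOrdGE a G)
    (hH : PolyOrdGE b H) : slice (a + b) (G * H) = slice a G * slice b H := by
  classical
  refine MvPolynomial.ext _ _ fun m => ?_
  rw [coeff_slice, coeff_mul, coeff_mul, HahnSeries.coeff_sum]
  exact Finset.sum_congr rfl fun ij _ => hahn_coeff_mul_of_isOrdGE (hG ij.1) (hH ij.2)

/-- The `ε^0`-slice of a real polynomial viewed over `ℝ((ε))` is itself. [folklore] -/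
theorem slice_zero_map_algebraMap (g : MvPolynomial σ ℝ) :
    slice 0 (MvPolynomial.map (algebraMap ℝ (LaurentSeries ℝ)) g) = g :=
  MvPolynomial.ext _ _ fun m => by rw [coeff_slice, coeff_map, algebraMap_laurentSeries_apply,
    HahnSeries.C_apply, HahnSeries.coeff_single_same]

open Classical in
/-- The `ε`-ORDER of `G ≠ 0` (least order of a coefficient). [cite: GrochowMulmuleyQiao2016] -/
def epsOrd (G : MvPolynomial σ (LaurentSeries ℝ)) : ℤ :=
  if h : G.support.Nonempty then G.support.inf' h (fun m => (coeff m G).order) else 0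

/-- `G = O(ε^{epsOrd G})`. [folklore] -/
theorem polyOrdGE_epsOrd (G : MvPolynomial σ (LaurentSeries ℝ)) : PolyOrdGE (epsOrd G) G := by
  intro m i hi
  by_cases hm : m ∈ G.support
  · refine HahnSeries.coeff_eq_zero_of_lt_order (lt_of_lt_of_le hi ?_)
    rw [epsOrd, dif_pos ⟨m, hm⟩]
    exact Finset.inf'_le _ hm
  · rw [notMem_support_iff.1 hm, HahnSeries.coeff_zero]

/-- The LOWEST-ORDER PART `slice (epsOrd G) G` of `G ≠ 0` is nonzero. [folklore] -/
theorem slice_epsOrd_ne_zero {G : MvPolynomial σ (LaurentSeries ℝ)} (hG : G ≠ 0) :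
    slice (epsOrd G) G ≠ 0 := by
  have hne : G.support.Nonempty := Finset.nonempty_iff_ne_empty.2 fun h => hG (support_eq_empty.1 h)
  obtain ⟨m, hm, h⟩ := Finset.exists_mem_eq_inf' hne fun m => (coeff m G).order
  intro h0
  have h1 := congr_arg (coeff m) h0
  rw [coeff_slice, coeff_zero, epsOrd, dif_pos hne, h, HahnSeries.coeff_order_eq_zero] at h1
  exact mem_support_iff.1 hm h1

/-- A nonzero `ε^a`-slice ⇒ `G ≠ 0` and `epsOrd G ≤ a`. [folklore] -/
theorem epsOrd_le_of_slice_ne_zero {a : ℤ} {G : MvPolynomial σ (LaurentSeries ℝ)}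
    (h : slice a G ≠ 0) : G ≠ 0 ∧ epsOrd G ≤ a := by
  refine ⟨by rintro rfl; exact h (slice_zero a), ?_⟩
  obtain ⟨m, hm⟩ := exists_coeff_ne_zero h
  rw [coeff_slice] at hm
  have hms : m ∈ G.support := mem_support_iff.2 fun h0 => hm (by rw [h0, HahnSeries.coeff_zero])
  rw [epsOrd, dif_pos ⟨m, hms⟩]
  exact (Finset.inf'_le _ hms).trans (HahnSeries.order_le_of_coeff_ne_zero hm)

/-- Characterisation of the order: `G = O(ε^a)` with a nonzero `ε^a`-slice. [folklore] -/
theorem epsOrd_eq {a : ℤ} {G : MvPolynomial σ (LaurentSeries ℝ)} (h1 : PolyOrdGE a G)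
    (h2 : slice a G ≠ 0) : epsOrd G = a :=
  le_antisymm (epsOrd_le_of_slice_ne_zero h2).2 <| le_of_not_gt fun hlt =>
    slice_epsOrd_ne_zero (epsOrd_le_of_slice_ne_zero h2).1 (slice_eq_zero_of_polyOrdGE h1 hlt)

/-- The lowest-order part of a real polynomial viewed over `ℝ((ε))` is itself. [folklore] -/
theorem slice_epsOrd_map_algebraMap (g : MvPolynomial σ ℝ) :
    slice (epsOrd (MvPolynomial.map (algebraMap ℝ (LaurentSeries ℝ)) g))
      (MvPolynomial.map (algebraMap ℝ (LaurentSeries ℝ)) g) = g := by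
  by_cases hg : g = 0
  · rw [hg, map_zero, slice_zero]
  · rw [epsOrd_eq (PolyOrdGE.map_algebraMap g) (by rw [slice_zero_map_algebraMap]; exact hg),
      slice_zero_map_algebraMap]

/-- The lowest-order part of a constant `c` with `0 ≤ c.leadingCoeff`, over `ℝ≥0`. [folklore] -/
theorem slice_epsOrd_C {c : LaurentSeries ℝ} (hc : 0 ≤ c.leadingCoeff) :
    MvPolynomial.map NNReal.toRealHom (C c.leadingCoeff.toNNReal : MvPolynomial σ ℝ≥0) =
      slice (epsOrd (C c : MvPolynomial σ (LaurentSeries ℝ))) (C c) := by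
  classical
  rw [map_C, show NNReal.toRealHom c.leadingCoeff.toNNReal = _ from Real.coe_toNNReal _ hc]
  by_cases h0 : c = 0
  · rw [h0, HahnSeries.leadingCoeff_zero, C_0, C_0, slice_zero]
  have hsl : slice c.order (C c : MvPolynomial σ (LaurentSeries ℝ)) = C c.leadingCoeff :=
    MvPolynomial.ext _ _ fun m => by
      rw [coeff_slice, coeff_C, coeff_C, HahnSeries.leadingCoeff_eq]
      split_ifs; exacts [rfl, HahnSeries.coeff_zero]
  rw [epsOrd_eq (PolyOrdGE.C fun i hi => HahnSeries.coeff_eq_zero_of_lt_order hi)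
    (by rwa [hsl, Ne, C_eq_zero, HahnSeries.leadingCoeff_eq_zero]), hsl]

/-- Nonnegative real polynomials do not cancel: `p ≠ 0 ⇒ p + q ≠ 0`. [folklore] -/
theorem add_ne_zero_of_nonneg {p q : MvPolynomial σ ℝ} (hp : ∀ m, 0 ≤ coeff m p)
    (hq : ∀ m, 0 ≤ coeff m q) (h : p ≠ 0) : p + q ≠ 0 := by
  obtain ⟨m, hm⟩ := exists_coeff_ne_zero h
  refine fun h0 => (add_pos_of_pos_of_nonneg (lt_of_le_of_ne (hp m) (Ne.symm hm)) (hq m)).ne' ?_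
  rw [← coeff_add, h0, coeff_zero]

/-- **No cancellation at a sum gate**: lowest-order parts of `A ≠ 0`, `B` nonnegative ⇒ `A + B ≠ 0`
with order at most that of `A`. [cite: GrochowMulmuleyQiao2016, Thm. 16 (arXiv:1605.02815)] -/
theorem epsOrd_add_le {A B : MvPolynomial σ (LaurentSeries ℝ)}
    (hA : ∀ m, 0 ≤ coeff m (slice (epsOrd A) A)) (hB : ∀ m, 0 ≤ coeff m (slice (epsOrd B) B))
    (hA0 : A ≠ 0) : A + B ≠ 0 ∧ epsOrd (A + B) ≤ epsOrd A := by
  by_cases hB0 : B = 0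
  · rw [hB0, add_zero]; exact ⟨hA0, le_rfl⟩
  have hsl : ∀ {C : MvPolynomial σ (LaurentSeries ℝ)} {μ : ℤ}, μ ≤ epsOrd C →
      (∀ m, 0 ≤ coeff m (slice (epsOrd C) C)) → ∀ m, 0 ≤ coeff m (slice μ C) := by
    intro C μ hμ hC m
    rcases hμ.lt_or_eq with h | rfl
    · rw [slice_eq_zero_of_polyOrdGE (polyOrdGE_epsOrd C) h, coeff_zero]
    · exact hC m
  have key : ∀ μ : ℤ, μ ≤ epsOrd A → μ ≤ epsOrd B → (μ = epsOrd A ∨ μ = epsOrd B) →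
      A + B ≠ 0 ∧ epsOrd (A + B) ≤ μ := fun μ hμA hμB hμ => epsOrd_le_of_slice_ne_zero <| by
    rw [slice_add]
    rcases hμ with rfl | rfl
    · exact add_ne_zero_of_nonneg hA (hsl hμB hB) (slice_epsOrd_ne_zero hA0)
    · exact add_comm (slice _ A) _ ▸
        add_ne_zero_of_nonneg hB (hsl hμA hA) (slice_epsOrd_ne_zero hB0)
  rcases le_total (epsOrd A) (epsOrd B) with h | h
  · exact key _ le_rfl h (Or.inl rfl)
  · exact (key _ h le_rfl (Or.inr rfl)).imp_right fun h3 => h3.trans h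

/-- **No cancellation at a product gate.** [cite: GrochowMulmuleyQiao2016, Thm. 16] -/
theorem slice_epsOrd_mul {A B : MvPolynomial σ (LaurentSeries ℝ)} (hA0 : A ≠ 0) (hB0 : B ≠ 0) :
    slice (epsOrd (A * B)) (A * B) = slice (epsOrd A) A * slice (epsOrd B) B := by
  have hmul := slice_mul (polyOrdGE_epsOrd A) (polyOrdGE_epsOrd B)
  rw [epsOrd_eq ((polyOrdGE_epsOrd A).mul (polyOrdGE_epsOrd B))
    (hmul ▸ mul_ne_zero (slice_epsOrd_ne_zero hA0) (slice_epsOrd_ne_zero hB0)), hmul]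

open Classical in
/-- The debordered OPERAND of gate `i`: the constant `0` if its value is nonzero of `ε`-order other
than the gate value's, else constants ↦ leading coefficients. [cite: GrochowMulmuleyQiao2016] -/
def debOp (P : ArithCircuit (LaurentSeries ℝ) σ) (i : ℕ)
    (u : ArithCircuit.Operand (LaurentSeries ℝ) σ) : ArithCircuit.Operand ℝ≥0 σ :=
  if P.opVal i u ≠ 0 ∧ epsOrd (P.opVal i u) ≠ epsOrd (P.gateVal i) then ArithCircuit.Operand.const 0
  else u.map fun c => c.leadingCoeff.toNNReal

/-- The DEBORDERED CIRCUIT over `ℝ≥0`: same gate list, constants ↦ leading coefficients, `⊕`-gate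
`i` gets coefficients `1` and operands `debOp P i`. [cite: GrochowMulmuleyQiao2016, Thm. 16] -/
def deborder (P : ArithCircuit (LaurentSeries ℝ) σ) : ArithCircuit ℝ≥0 σ where
  gates := P.gates.mapIdx fun i g => match g with
    | .prod args => .prod (args.map (ArithCircuit.Operand.map fun c => c.leadingCoeff.toNNReal))
    | .sum args => .sum (args.map fun a => (1, debOp P i a.2))
  output := P.output.map fun c => c.leadingCoeff.toNNReal

/-- Same size. [folklore] -/
theorem size_deborder (P : ArithCircuit (LaurentSeries ℝ) σ) : (deborder P).size = P.size := by
  simp [deborder, ArithCircuit.size]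

/-- `countP` through a predicate-preserving `mapIdx`. [folklore] -/
theorem countP_mapIdx_of {α β : Type*} (p : α → Bool) (q : β → Bool) :
    ∀ (l : List α) (f : ℕ → α → β), (∀ i a, q (f i a) = p a) → (l.mapIdx f).countP q = l.countP p
  | [], _, _ => by simp
  | a :: l, f, h => by rw [List.mapIdx_cons, List.countP_cons, List.countP_cons, h,
      countP_mapIdx_of p q l _ fun i a => h (i + 1) a]

/-- Same `⊗`-count. [folklore] -/
theorem prodCount_deborder (P : ArithCircuit (LaurentSeries ℝ) σ) :
    prodCount (deborder P) = prodCount P := by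
  unfold prodCount
  exact countP_mapIdx_of _ _ P.gates _ fun i g => by cases g <;> rfl

/-- Fan-in two and plainness of the debordered circuit. [folklore] -/
theorem isFanInTwo_isPlain_deborder {P : ArithCircuit (LaurentSeries ℝ) σ} (h : P.IsFanInTwo) :
    (deborder P).IsFanInTwo ∧ IsPlain (deborder P) := by
  constructor <;> intro g hg <;> obtain ⟨i, hi, rfl⟩ := List.mem_mapIdx.1 hg
  · have hf := h _ (List.getElem_mem hi)
    revert hf
    cases P.gates[i] <;> simp [ArithCircuit.Gate.fanIn, ArithCircuit.Gate.args]
  · cases P.gates[i] with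
    | prod args => exact isPlainGate_prod _
    | sum args =>
      refine (isPlainGate_sum_iff _).2 fun a ha => ?_
      obtain ⟨b, _, rfl⟩ := List.mem_map.1 ha
      rfl

/-- Operands (given the mechanism below gate `i`). [cite: GrochowMulmuleyQiao2016, Thm. 16] -/
theorem map_opVal_deborder (P : ArithCircuit (LaurentSeries ℝ) σ) (i : ℕ)
    (IH : ∀ j < i, MvPolynomial.map NNReal.toRealHom ((deborder P).gateVal j) =
      slice (epsOrd (P.gateVal j)) (P.gateVal j))
    (u : ArithCircuit.Operand (LaurentSeries ℝ) σ)
    (hu : ∀ c, u = ArithCircuit.Operand.const c → 0 ≤ c.leadingCoeff) :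
    MvPolynomial.map NNReal.toRealHom
        ((deborder P).opVal i (u.map fun c => c.leadingCoeff.toNNReal)) =
      slice (epsOrd (P.opVal i u)) (P.opVal i u) := by
  cases u with
  | var v => simpa only [ArithCircuit.Operand.map, ArithCircuit.opVal_var, map_X] using
      (slice_epsOrd_map_algebraMap (X v : MvPolynomial σ ℝ)).symm
  | const c => exact slice_epsOrd_C (hu c rfl)
  | gate j =>
    simp only [ArithCircuit.Operand.map, ArithCircuit.opVal_gate]
    split_ifs with hj
    exacts [IH j hj, by rw [map_zero, slice_zero]]

/-- **THE MECHANISM.** For a plain fan-in-two `P` over `ℝ((ε))` with `ε`-positive constants, gate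
`i` of `deborder P` computes the lowest-order part of gate `i`. [cite: GrochowMulmuleyQiao2016] -/
theorem map_gateVal_deborder (P : ArithCircuit (LaurentSeries ℝ) σ) (h2 : P.IsFanInTwo)
    (hpl : IsPlain P)
    (hpos : ∀ g ∈ P.gates, ∀ c, ArithCircuit.Operand.const c ∈ g.args → 0 ≤ c.leadingCoeff)
    (i : ℕ) : MvPolynomial.map NNReal.toRealHom ((deborder P).gateVal i) =
      slice (epsOrd (P.gateVal i)) (P.gateVal i) := by
  classical
  induction i using Nat.strong_induction_on with
  | _ i IH =>
  have hop := map_opVal_deborder P i IH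
  rcases hg : P.gates[i]? with _ | g
  · have hi : P.size ≤ i := List.getElem?_eq_none_iff.1 hg
    rw [ArithCircuit.gateVal_of_le P hi, slice_zero,
      ArithCircuit.gateVal_of_le _ ((size_deborder P).le.trans hi), map_zero]
  have hmem : g ∈ P.gates := List.mem_of_getElem? hg; have hfan := h2 _ hmem
  have hQ : (deborder P).gates[i]? = _ := List.getElem?_mapIdx
  rw [hg, Option.map_some] at hQ
  rcases g with args | args
  · have hposu : ∀ a ∈ args, ∀ c, a.2 = ArithCircuit.Operand.const c → 0 ≤ c.leadingCoeff :=
      fun a ha c hc => hpos _ hmem c (List.mem_map.2 ⟨a, ha, hc⟩)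
    have hone : ∀ a ∈ args, a.1 = 1 := (isPlainGate_sum_iff args).1 (hpl _ hmem)
    have hnn : ∀ a ∈ args, ∀ m, 0 ≤ coeff m (slice (epsOrd (P.opVal i a.2)) (P.opVal i a.2)) :=
      fun a ha m => by rw [← hop a.2 (hposu a ha), coeff_map]; exact NNReal.coe_nonneg _
    have hterm : ∀ a ∈ args, (P.opVal i a.2 ≠ 0 → epsOrd (P.gateVal i) ≤ epsOrd (P.opVal i a.2)) →
        MvPolynomial.map NNReal.toRealHom ((deborder P).opVal i (debOp P i a.2)) =
          slice (epsOrd (P.gateVal i)) (P.opVal i a.2) := by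
      intro a ha hle
      by_cases hc : P.opVal i a.2 ≠ 0 ∧ epsOrd (P.opVal i a.2) ≠ epsOrd (P.gateVal i)
      · rw [debOp, if_pos hc, ArithCircuit.opVal_const, C_0, map_zero, slice_eq_zero_of_polyOrdGE
          (polyOrdGE_epsOrd _) (lt_of_le_of_ne (hle hc.1) (Ne.symm hc.2))]
      · rw [debOp, if_neg hc, hop a.2 (hposu a ha)]
        by_cases h0 : P.opVal i a.2 = 0
        · rw [h0, slice_zero, slice_zero]
        · rw [not_not.1 fun hne => hc ⟨h0, hne⟩]
    have hPi := ArithCircuit.gateVal_of_sum P hg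
    rw [ArithCircuit.gateVal_of_sum (deborder P) hQ, List.map_map]
    rcases args with _ | ⟨a, _ | ⟨b, _ | ⟨z, rest⟩⟩⟩
    · rw [hPi, List.map_nil, List.map_nil, List.sum_nil, List.sum_nil, map_zero, slice_zero]
    · simp only [List.map_cons, List.map_nil, List.sum_cons, List.sum_nil, add_zero,
        Function.comp_apply, one_smul] at hPi ⊢
      rw [hone a (by simp), one_smul] at hPi
      rw [hterm a (by simp) fun _ => (congr_arg epsOrd hPi).le, hPi]
    · simp only [List.map_cons, List.map_nil, List.sum_cons, List.sum_nil, add_zero,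
        Function.comp_apply, one_smul] at hPi ⊢
      rw [hone a (by simp), hone b (by simp), one_smul, one_smul] at hPi
      have hA := fun h0 => (epsOrd_add_le (hnn a (by simp)) (hnn b (by simp)) h0).2
      have hB := fun h0 => (epsOrd_add_le (hnn b (by simp)) (hnn a (by simp)) h0).2
      rw [map_add, hterm a (by simp) fun h0 => by rw [hPi]; exact hA h0,
        hterm b (by simp) fun h0 => by rw [hPi, add_comm]; exact hB h0, hPi, slice_add]
    · simp [ArithCircuit.Gate.fanIn, ArithCircuit.Gate.args] at hfan
  · have hposu : ∀ u ∈ args, ∀ c, u = ArithCircuit.Operand.const c → 0 ≤ c.leadingCoeff :=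
      fun u hu c hc => hpos _ hmem c (by rw [← hc]; exact hu)
    rw [ArithCircuit.gateVal_of_prod P hg, ArithCircuit.gateVal_of_prod (deborder P) hQ,
      List.map_map]
    rcases args with _ | ⟨u, _ | ⟨w, _ | ⟨z, rest⟩⟩⟩
    · rw [List.map_nil, List.map_nil, List.prod_nil, List.prod_nil, map_one,
        ← map_one (MvPolynomial.map (algebraMap ℝ (LaurentSeries ℝ))), slice_epsOrd_map_algebraMap]
    · simp only [List.map_cons, List.map_nil, List.prod_cons, List.prod_nil, mul_one,
        Function.comp_apply]
      exact hop u (hposu u (by simp))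
    · simp only [List.map_cons, List.map_nil, List.prod_cons, List.prod_nil, mul_one,
        Function.comp_apply, map_mul]
      rw [hop u (hposu u (by simp)), hop w (hposu w (by simp))]
      by_cases hu0 : P.opVal i u = 0
      · rw [hu0, slice_zero, zero_mul, zero_mul, slice_zero]
      by_cases hw0 : P.opVal i w = 0
      · rw [hw0, slice_zero, mul_zero, mul_zero, slice_zero]
      exact (slice_epsOrd_mul hu0 hw0).symm
    · simp [ArithCircuit.Gate.fanIn, ArithCircuit.Gate.args] at hfan

/-- ★ **MONOTONE BORDER = MONOTONE EXACT.** If a plain fan-in-two circuit over `ℝ((ε))` with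
`ε`-positive constants computes `f + O(ε)`, `f ∈ ℝ≥0[x]`, then `f` has a monotone computation
(Jerrum–Snir) with at most as many gates and product gates (in print for toric degenerations,
and for ABPs: [cite: BlaserIkenmeyerMahajanPandeySaurabh2020, Thm. 3]).
[cite: GrochowMulmuleyQiao2016, Thm. 16] -/
theorem exists_isMonotoneComputation_of_border (P : ArithCircuit (LaurentSeries ℝ) σ)
    (f : MvPolynomial σ ℝ≥0) (h2 : P.IsFanInTwo) (hpl : IsPlain P)
    (hpos : ∀ g ∈ P.gates, ∀ c, ArithCircuit.Operand.const c ∈ g.args → 0 ≤ c.leadingCoeff)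
    (hout : ∀ c, P.output = ArithCircuit.Operand.const c → 0 ≤ c.leadingCoeff)
    (happrox : PolyOrdGE 1 (P.eval -
      MvPolynomial.map ((algebraMap ℝ (LaurentSeries ℝ)).comp NNReal.toRealHom) f)) :
    ∃ Q : ArithCircuit ℝ≥0 σ, IsMonotoneComputation Q f ∧ Q.size ≤ P.size ∧
      prodCount Q ≤ prodCount P := by
  have hinj : Function.Injective (MvPolynomial.map (σ := σ) NNReal.toRealHom) :=
    MvPolynomial.map_injective _ fun a b hab => NNReal.coe_injective hab
  by_cases hf : f = 0
  · refine ⟨ArithCircuit.ofConst 0, ⟨fun g hg => by simp [ArithCircuit.ofConst] at hg, fun g hg =>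
      by simp [ArithCircuit.ofConst] at hg, ?_⟩, Nat.zero_le _, Nat.zero_le _⟩
    rw [ArithCircuit.Computes, ArithCircuit.eval_ofConst, C_0, hf]
  rw [← MvPolynomial.map_map] at happrox
  set g : MvPolynomial σ ℝ := MvPolynomial.map NNReal.toRealHom f with hgdef
  have hg0 : g ≠ 0 := fun h => hf (hinj (by rw [← hgdef, h, map_zero]))
  have hsplit := (sub_add_cancel P.eval (MvPolynomial.map (algebraMap ℝ (LaurentSeries ℝ)) g)).symm
  have hsl : slice 0 P.eval = g := by rw [hsplit, slice_add, slice_eq_zero_of_polyOrdGE happrox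
    zero_lt_one, zero_add, slice_zero_map_algebraMap]
  have hord : epsOrd P.eval = 0 := epsOrd_eq
    (by rw [hsplit]; exact (happrox.mono zero_le_one).add (PolyOrdGE.map_algebraMap g))
    (by rw [hsl]; exact hg0)
  refine ⟨deborder P, ⟨(isFanInTwo_isPlain_deborder h2).1, (isFanInTwo_isPlain_deborder h2).2,
    hinj ?_⟩, (size_deborder P).le, (prodCount_deborder P).le⟩
  rw [← hgdef, ← hsl, ← hord, ArithCircuit.eval_eq_opVal_output (deborder P),
    ArithCircuit.eval_eq_opVal_output P, size_deborder]
  exact map_opVal_deborder P P.size (fun j _ => map_gateVal_deborder P h2 hpl hpos j) P.output hout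

/-- ★ **BORDER JS82 (unconditional).** Every plain fan-in-two circuit over `ℝ((ε))` with
`ε`-positive constants computing `per_n + O(ε)` (`n ≥ 1`) has at least `n(2^{n-1} - 1)` product
gates (the tree's THEOREM `JerrumSnir1982_permanent_holds`, debordered). [cite: JerrumSnir1982] -/
theorem border_jerrumSnir_permanent {n : ℕ} (hn : 1 ≤ n)
    (P : ArithCircuit (LaurentSeries ℝ) (Fin n × Fin n)) (h2 : P.IsFanInTwo) (hpl : IsPlain P)
    (hpos : ∀ g ∈ P.gates, ∀ c, ArithCircuit.Operand.const c ∈ g.args → 0 ≤ c.leadingCoeff)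
    (hout : ∀ c, P.output = ArithCircuit.Operand.const c → 0 ≤ c.leadingCoeff)
    (happrox : PolyOrdGE 1 (P.eval - MvPolynomial.map
      ((algebraMap ℝ (LaurentSeries ℝ)).comp NNReal.toRealHom) (perPoly (Fin n) ℝ≥0))) :
    n * (2 ^ (n - 1) - 1) ≤ prodCount P := by
  obtain ⟨Q, hQ, -, hc⟩ := exists_isMonotoneComputation_of_border P _ h2 hpl hpos hout happrox
  exact ((JerrumSnir1982_permanent_holds n hn).1 Q hQ).trans hc

/-- ★ **The `MonotoneGap` barrier is BORDER-ROBUST**: `ST ∈ VP`, yet for some `c > 0` and all large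
`N` every plain fan-in-two circuit over `ℝ((ε))` with `ε`-positive constants computing
`ST_{N+1} + O(ε)` has `≥ 2^{cN}` product gates (JS82 §4.5 debordered). [cite: JerrumSnir1982] -/
theorem monotoneGap_border_robust : isVPFamily_stPoly ∧
    ∃ c : ℝ, 0 < c ∧ ∃ N₀ : ℕ, ∀ N : ℕ, N₀ ≤ N →
      ∀ P : ArithCircuit (LaurentSeries ℝ) (Fin N × Option (Fin N)), P.IsFanInTwo → IsPlain P →
        (∀ g ∈ P.gates, ∀ c, ArithCircuit.Operand.const c ∈ g.args → 0 ≤ c.leadingCoeff) →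
        (∀ c, P.output = ArithCircuit.Operand.const c → 0 ≤ c.leadingCoeff) →
        PolyOrdGE 1 (P.eval - MvPolynomial.map
          ((algebraMap ℝ (LaurentSeries ℝ)).comp NNReal.toRealHom) (stPoly ℝ≥0 N)) →
        (2 : ℝ) ^ (c * N) ≤ prodCount P := by
  obtain ⟨c, hc, N₀, h⟩ := JerrumSnir1982_spanningTree_holds
  refine ⟨isVPFamily_stPoly_holds, c, hc, N₀, fun N hN P h2 hpl hpos hout happrox => ?_⟩
  obtain ⟨Q, hQ, -, hcnt⟩ := exists_isMonotoneComputation_of_border P _ h2 hpl hpos hout happrox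
  exact (h N hN Q hQ).trans (by exact_mod_cast hcnt)

end Summit.ValiantsHypothesis.ValiantsHypothesis.Theorems.VPBoundarySquare

end
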